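import Mathlib
import HarnessLib.Audit
import HarnessLib

/-!
# L3TimeExponentPincer — ring datum calculus XII: the polar test ball

Support kernel for the crux `L3CascadeJaw` (item stmt-NavierStokesRegularity-19499): the
energy LOWER bound `ofReal E ≤ ∫⁻ ‖u₀‖ₑ²` of `lpPersistence_of_ringData` is read off a small ball
on the symmetry axis inside the dipole zone (`ofReal_le_lintegral_of_le_on_ball`,
`norm_ringField_sq_ge`, `axial_factor_ge`).  Here: for `ℓ > 0` and
`x ∈ ball ((17ℓ/10) e₂) (ℓ/10)` one has `2ℓ² ≤ |x|² ≤ 4ℓ²` and `x₀² + x₁² ≤ |x|²/4`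
(`polarBall_norm_sq_ge`, `polarBall_norm_sq_le`, `polarBall_cyl_sq_le`).
WHAT THIS IS NOT: elementary geometry in `ℝ³`.
-/

namespace Summit.NavierStokesRegularity.NavierStokesRegularity.Theorems.L3TimeExponentPincerRingDatumPolarBall

open Real Set Metric

/-- The axis point `(17ℓ/10) e₂` has norm `17ℓ/10` (`ℓ ≥ 0`). -/
theorem norm_axisPoint {ℓ : ℝ} (hℓ : 0 ≤ ℓ) :
    ‖(EuclideanSpace.single (2 : Fin 3) (17 * ℓ / 10) : EuclideanSpace ℝ (Fin 3))‖ = 17 * ℓ / 10 := by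
  rw [EuclideanSpace.single, PiLp.norm_single, Real.norm_eq_abs, abs_of_nonneg (by positivity)]

variable {ℓ : ℝ} {x : EuclideanSpace ℝ (Fin 3)}

/-- On the polar test ball, `16ℓ/10 ≤ ‖x‖ ≤ 18ℓ/10`. -/
theorem polarBall_norm_mem (hℓ : 0 < ℓ)
    (hx : x ∈ ball (EuclideanSpace.single (2 : Fin 3) (17 * ℓ / 10) : EuclideanSpace ℝ (Fin 3)) (ℓ / 10)) :
    16 * ℓ / 10 ≤ ‖x‖ ∧ ‖x‖ ≤ 18 * ℓ / 10 := by
  rw [mem_ball, dist_eq_norm] at hx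
  have h := abs_norm_sub_norm_le x (EuclideanSpace.single (2 : Fin 3) (17 * ℓ / 10))
  rw [norm_axisPoint hℓ.le, abs_le] at h
  constructor <;> linarith [h.1, h.2]

/-- **`2ℓ² ≤ |x|²` on the polar test ball.** -/
theorem polarBall_norm_sq_ge (hℓ : 0 < ℓ)
    (hx : x ∈ ball (EuclideanSpace.single (2 : Fin 3) (17 * ℓ / 10) : EuclideanSpace ℝ (Fin 3)) (ℓ / 10)) :
    2 * ℓ ^ 2 ≤ ‖x‖ ^ 2 := by
  have h := (polarBall_norm_mem hℓ hx).1
  nlinarith [norm_nonneg x]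

/-- **`|x|² ≤ 4ℓ²` on the polar test ball.** -/
theorem polarBall_norm_sq_le (hℓ : 0 < ℓ)
    (hx : x ∈ ball (EuclideanSpace.single (2 : Fin 3) (17 * ℓ / 10) : EuclideanSpace ℝ (Fin 3)) (ℓ / 10)) :
    ‖x‖ ^ 2 ≤ 4 * ℓ ^ 2 := by
  have h := (polarBall_norm_mem hℓ hx).2
  nlinarith [norm_nonneg x]

/-- `x₀² + x₁² ≤ ‖x − c e₂‖²`: the distance to an axis point controls the cylindrical radius. -/
theorem cyl_sq_le_norm_sub_axis_sq (x : EuclideanSpace ℝ (Fin 3)) (c : ℝ) :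
    x 0 ^ 2 + x 1 ^ 2 ≤ ‖x - EuclideanSpace.single (2 : Fin 3) c‖ ^ 2 := by
  rw [EuclideanSpace.norm_sq_eq, Fin.sum_univ_three]
  simp only [PiLp.sub_apply, EuclideanSpace.single, PiLp.single_apply, Real.norm_eq_abs, sq_abs,
    if_neg (show (0 : Fin 3) ≠ 2 by decide), if_neg (show (1 : Fin 3) ≠ 2 by decide), sub_zero]
  nlinarith [sq_nonneg (x 2 - c)]

/-- **`x₀² + x₁² ≤ |x|²/4` on the polar test ball** (indeed `≤ ℓ²/100 ≤ 2ℓ²/4`). -/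
theorem polarBall_cyl_sq_le (hℓ : 0 < ℓ)
    (hx : x ∈ ball (EuclideanSpace.single (2 : Fin 3) (17 * ℓ / 10) : EuclideanSpace ℝ (Fin 3)) (ℓ / 10)) :
    x 0 ^ 2 + x 1 ^ 2 ≤ ‖x‖ ^ 2 / 4 := by
  have h2 := polarBall_norm_sq_ge hℓ hx
  rw [mem_ball, dist_eq_norm] at hx
  have h1 := cyl_sq_le_norm_sub_axis_sq x (17 * ℓ / 10)
  have h3 : ‖x - EuclideanSpace.single (2 : Fin 3) (17 * ℓ / 10)‖ ^ 2 ≤ (ℓ / 10) ^ 2 :=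
    pow_le_pow_left₀ (norm_nonneg _) hx.le 2
  nlinarith

end Summit.NavierStokesRegularity.NavierStokesRegularity.Theorems.L3TimeExponentPincerRingDatumPolarBall
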